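/-
Copyright: the b2b-balaban T⁴-continuum CRUX team, row NE7b, leaf lineage `t4-ne7b-formalise-leaf-02` (gen 132). Project licence.
-/
import Summits.QuantumFields.BalabanUV.T4Continuum.Spine.NE7b.OneStepCovariantStokes
import Summits.QuantumFields.BalabanUV.T4Continuum.Spine.NE7b.OneStepLoopLettersValue

/-!
# LEMMA CS (ii) AT ONE STEP, BY VALUE — the junction: `…OneStepCovariantStokes.norm_coarseCurl_Q0cov_le` with its three loop letters DISCHARGED by
# `…OneStepLoopLettersValue` at the averaged coarse background `V = V̄₀` under the plaquette regularity (44)∕(109): for a `U(N)`-type fine background,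
# `‖(∂_{V̄₀} Q₀A)(P)‖ ≤ Σ_r L^{−(d+1)}·(‖(R_{0,x_r}A)(∂S_{x_r}(P))‖ + 640(d+1)(d+4)L²α₀ · Σ_{three sides}‖A_b‖)` — the memo's
# «`+ c_g ε_F Σ_x η^d Σ_{b∈∂S_x(P)} η|A(b)|`» at `k = 1` with `c_g ε_F = 640(d+1)(d+4)L²α₀` (row NE7b, node U5c; `SectE-interface-proof.md` §5.2 Lemma CS;
# the chairs' located asks ι-X-OSCS-1 ∕ ι-X-OSLL-2 «a junction once both oleans exist»)

Cell `pub-balaban`, sub-cell `t4`, spine estimate NE7b (`T4WeightBudget.RelWeightBound`; the cell's OWN estimate — NOT PRINTED in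
[Bałaban 1983–89], NOT PROVED).  Crux-route work under `Spine/NE7b/` by the row's E-side ∕ key-readings ∕ lattice-geometry leaf lineage; NOTHING
of Bałaban's is asserted beyond what the imported modules prove; no `T4Continuum/Support` leaf typed; no `def`, no notation; zero `sorry`.  Imports (this
lineage, gen 132): `…OneStepCovariantStokes` (p382839 ✓) and `…OneStepLoopLettersValue` (part II of the loop letters) — BY NAME, one `fun r ↦ …` per letter.

WHAT IS PROVED ([folklore] junction): **`norm_coarseCurl_Q0cov_bavg_le`** — for `𝔸` a non-trivial C⋆-algebra (print: `M_N(ℂ)`, `G = U(N)`), `V₀` unitary-valued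
with `‖V₀(∂p) − 1‖ ≤ α₀` on `ℤ^d`, `512(d+1)(d+4)L²α₀ ≤ 1`, `1 ≤ L`, every fine 1-form `A` and every coarse plaquette `P = (q; κ, μ)`: the covariant
coarse curl of the (125)-field with respect to the AVERAGED background `V̄₀` (`B7Prop1Explicit.bavg`) is bounded by the block average of the rotated
boundary sums `Z_r = (R_{0,x_r}A)(∂S_{x_r}(P))` plus `2·320(d+1)(d+4)L²α₀` times the three side sums of `‖A‖` — OSCS's `hδ₂ ∕ hδ₃ ∕ hδ₄` supplied by
`delta2∕3∕4_le_of_pdev` (`80, 240 ≤ 320`), its `huᵢ` by `bavg_mem_U1_of_pdev`.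

NOT HERE (honest): step (i) (`‖Z_r‖` against the transported curls: leaf-05's `LinearisedLatticeStokesRectangle` END through `RotatedSumPairHolonomy` §5
at `G = U(n)`), the counting (iii), (R-M), `k > 1`, normalisations; (A3) ∕ (A1c), NC-NE7b-α UNRULED.  BY-NAME EFFECT ON THE WALL: NONE.  NE7b NOT
PRINTED ∕ NOT PROVED; spine PROVED 0∕9; rung (B)+1 on a FINITE torus — NOT infinite volume, NOT the mass gap, NOT Clay.
HONEST DEPENDENCY: continuum YM on T⁴ ⇐ BetaPertH ∧ nine spine estimates (0/9 proved); BetaPertH ⇐ (D1) ∧ (D4) ∧ CAP+tail; G-an2-4 gates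
asym, D1 and NE2/3/4.
-/

set_option autoImplicit false

noncomputable section

open scoped BigOperators
open Literature.MathematicalPhysics.QuantumFieldTheory.Balaban1983to89
open Literature.MathematicalPhysics.QuantumFieldTheory.Balaban1983to89.B7Prop1Explicit (Site e hol seg treeWord boxVec bavg plaqWord U1)
open Literature.MathematicalPhysics.QuantumFieldTheory.Balaban1983to89.B7Eq78Linearization (conjR)
open Literature.MathematicalPhysics.QuantumFieldTheory.Balaban1983to89.B7Prop3GeneralRotated (tsum)
open Literature.MathematicalPhysics.QuantumFieldTheory.Balaban1983to89.B7Prop3GeneralLinear (Q0cov)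
open Summit.QuantumFields.BalabanUV.T4Continuum.NE7b.NonAbelianStokesBound (rectWord)
open Summit.QuantumFields.BalabanUV.T4Continuum.NE7b.OneStepLoopLettersValue
  (bavg_mem_U1_of_pdev delta2_le_of_pdev delta3_le_of_pdev delta4_le_of_pdev)

namespace Summit.QuantumFields.BalabanUV.T4Continuum.NE7b.OneStepCovariantStokesValue

variable {d : ℕ}
variable {𝔸 : Type*} [CStarAlgebra 𝔸] [Nontrivial 𝔸]
variable (L : ℕ) {V₀ : Site d → Fin d → 𝔸ˣ} (hV₀ : ∀ x κ, V₀ x κ ∈ B7Prop2Explicit.unitaryUnits 𝔸) (hL : 1 ≤ L) {α₀ : ℝ}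
  (hα₀ : 0 ≤ α₀) (hsmall : 512 * (d + 1) * (d + 4) * (L : ℝ) ^ 2 * α₀ ≤ 1)
  (h44 : ∀ (x : Site d) (κ κ' : Fin d), κ ≠ κ' → ‖((hol V₀ x (plaqWord κ κ') : 𝔸ˣ) : 𝔸) - 1‖ ≤ α₀)

include hV₀ hL hα₀ hsmall h44 in
/-- **LEMMA CS (ii) AT `k = 1`, BY VALUE, FOR THE AVERAGED COARSE BACKGROUND `V̄₀`**: OSCS's per-plaquette bound with `uᵢ = V̄₀(cᵢ)` and
`δ := 320(d+1)(d+4)L²α₀` — every loop letter discharged by `…OneStepLoopLettersValue`. [folklore] -/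
theorem norm_coarseCurl_Q0cov_bavg_le (A : Site d → Fin d → 𝔸) (q : Site d) (κ μ : Fin d) :
    ‖Q0cov L V₀ A q κ + conjR (bavg L V₀ q κ) (Q0cov L V₀ A (q + (L : ℤ) • e κ) μ)
      - conjR (bavg L V₀ q κ * bavg L V₀ (q + (L : ℤ) • e κ) μ * (bavg L V₀ (q + (L : ℤ) • e μ) κ)⁻¹)
          (Q0cov L V₀ A (q + (L : ℤ) • e μ) κ)
      - conjR (bavg L V₀ q κ * bavg L V₀ (q + (L : ℤ) • e κ) μ * (bavg L V₀ (q + (L : ℤ) • e μ) κ)⁻¹ * (bavg L V₀ q μ)⁻¹)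
          (Q0cov L V₀ A q μ)‖
    ≤ ∑ r : Fin d → Fin L, ((L : ℝ) ^ (d + 1))⁻¹ *
        ( ‖tsum V₀ A (q + boxVec L r) (rectWord κ μ L L)‖
          + 2 * (320 * (d + 1) * (d + 4) * (L : ℝ) ^ 2 * α₀)
            * ( ∑ i ∈ Finset.range L, ‖A (q + boxVec L r + (L : ℤ) • e κ + (i : ℤ) • e μ) μ‖
              + ∑ i ∈ Finset.range L, ‖A (q + boxVec L r + (L : ℤ) • e μ + (i : ℤ) • e κ) κ‖
              + ∑ i ∈ Finset.range L, ‖A (q + boxVec L r + (i : ℤ) • e μ) μ‖ ) ) := by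
  have hV₀' : ∀ x κ, V₀ x κ ∈ U1 𝔸 := fun x κ => B7Prop2Explicit.unitaryUnits_le_U1 (hV₀ x κ)
  have hb := bavg_mem_U1_of_pdev L hV₀ hL hα₀ hsmall h44
  have hc : (0 : ℝ) ≤ (d + 1) * (d + 4) * (L : ℝ) ^ 2 * α₀ := by positivity
  exact OneStepCovariantStokes.norm_coarseCurl_Q0cov_le L hV₀' A q κ μ (hb _ _) (hb _ _) (hb _ _) (hb _ _) (by positivity)
    (fun r => (delta2_le_of_pdev L hV₀ hL hα₀ hsmall h44 q κ r).trans (by nlinarith))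
    (fun r => (delta3_le_of_pdev L hV₀ hL hα₀ hsmall h44 q κ μ r).trans (by nlinarith))
    (fun r => delta4_le_of_pdev L hV₀ hL hα₀ hsmall h44 q κ μ r)

end Summit.QuantumFields.BalabanUV.T4Continuum.NE7b.OneStepCovariantStokesValue

end
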